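import Literature.MathematicalPhysics.QuantumFieldTheory.Balaban1983to89.Beta.RemainderStepAdapterHolo
import Literature.MathematicalPhysics.QuantumFieldTheory.Balaban1983to89.TreeLengthCubeSystem

/-!
# [Balaban1987RG1] (1.7) p. 261 FROM [Balaban1988RG2Cluster] (2.13) p. 14: the (1.7)-factorization `hfac` of the
# row-(D4) leaf lists DERIVED from ACTIVITY-LEVEL locality — on a large torus, 𝐄^{(k+1)}(Y mod N) is the ℤ^d-localized
# functional of the window Y evaluated on the activities (`Beta.RemainderFacFromActivities`)

statement-level skeleton of published theorems with citation tags; proofs where landed; nothing here is a claim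
about the Yang–Mills mass gap.

HONEST FRAMING (cell rule).  Bookkeeping for the k-uniform remainder chain of row (D4) (`RemainderConst` ⇐ ONE
`ChainTFac190` instance, `Beta.RemainderDecay190`); discharges NOTHING of `BetaPertH`; NOT B12 Thm 2, NOT the continuum
limit, NOT Clay.  Unit `b2b-balaban-beta-an4` gen 95 (BINDER row D4 OWNER; cell pub-balaban).  Imports
`Beta.RemainderStepAdapterHolo` (the thin step object `StepObjectD4`, whose `E` IS (2.13): `locE` of the polymer gas
with the torus incompatibility `TTouch`) and `TreeLengthCubeSystem` (unit pv22: the CONCRETE finite polymer system of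
a window of ℤ^d — `Dom B`, the (2.11) incompatibility `Touch B`) ONLY; nothing edited.

WHAT.  The leaf `hfac` of `RemainderLocality.PolLeavesTFac` ∕ `RemainderLocalityHolo.PolLeavesTFac190H` (generation 10 of
this lineage) TYPES [I]'s printed locality (F1) — *"the term corresponding to a domain X depends on U_j restricted to
X"* (p. 261, after (1.7)); *"This limit exists by the localized representation (1.7)"* (p. 264, after (1.21)) — at
the level of the OUTPUT 𝐄^{(k+1)}: for n large the torus functional of the reduction `Y mod N n` FACTORS through an
n-independent functional `F Y` of the window.  [II] DEFINES 𝐄^{(k+1)}(X) by (2.13) as the X-localized part of log Ξ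
of the polymer gas with activities H(Z), Z ⊂ X, and the finite-volume cluster functionals are invariant under
injective relabelings of the polymer system (tree: `ClusterExpansion.truncatedWeight_image`, *"This is what identifies
clusters of different tori ∕ of ℤ^d in thermodynamic limits"*).  THIS FILE derives `hfac` from the ACTIVITIES:
* §1 (one torus with N cubes per direction, a window Y of ℤ^d in the box of radius R, 2R + 3 ≤ N): the reduction
  `W ↦ W mod N` is a BIJECTION from the localization domains inside Y (`TreeLengthCubeSystem.Dom Y`) onto the torus
  localization domains inside `Y mod N`, carrying the (2.11) incompatibility `Touch Y` to `TTouch` (`tadj_proj_iff`,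
  `ttouch_tproj_iff`, `tproj_dom_injective`, `tproj_liftDom`, `isDom_liftDom`) — generation 9's
  minimal-representative machinery (`RemainderLimitTorus.liftDom`, `vmaVec_proj_of_abs_le`, `adj_vmaVec`).
* §2 **`E_tproj_eq_locE_window`** — IF the activities of the torus sub-domains of `Y mod N` at a configuration φ are
  read off a window assignment `w : Dom Y → ℂ` (`H (W mod N) φ = w W`), THEN
  `E(Y mod N, φ) = locE (Touch Y) (·) w Y` — (2.13) over the torus EQUALS (2.13) over the window, by
  `truncatedWeight_image` along the bijection of §1.
* §3 **`eventually_fac_of_activities`** — THE LEAF `hfac` FROM ACTIVITY-LEVEL LOCALITY: for an exhausting torus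
  sequence, step objects `O n`, any seam `emb n X`, any read-out maps `r n : Wn n → V` and any sets `S n` (e.g. the
  α₂-ball and `restrictCLM`), IF eventually the activities of the sub-domains of `Y mod N n` along the seam are window
  functionals of the read-out — `(O n).H (W mod N n) (emb n (Y mod N n) v) = w W (r n v)` for `v ∈ S n` — THEN
  eventually `(O n).E (Y mod N n) (emb n (Y mod N n) v) = F Y (r n v)` with
  `F Y u := locE (Touch Y) (·) (fun W => w W u) Y` WRITTEN IN THE STATEMENT — the shape of `PolLeavesTFac190H.hfac`
  (and of generation 95's `RemainderDecay190SupNormLeaves.nonempty_polLeavesTFac190H_supNorm`'s input `hfac` with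
  `Wn n := TPt d (N n·M) → ℂ`, `r n := restrictCLM (N n·M) (e Y)`, `S n := ball 0 α₂`).
So on any carrier the (1.7) input of row (D4) moves from the OUTPUT 𝐄 to the ACTIVITIES H — where the object builders
(NODE O ∕ A; the gaps cell's activity records) work: locality + volume-independence of the localized activities.
WHAT IS *NOT* DONE: no activity of Bałaban's is constructed, and their locality ∕ volume-independence (the restricted
propagators G_k(Z̃), [II] (2.16) ff.) is NOT proved here — it is the hypothesis `hloc`; row D4 class UNCHANGED
(instance 0∕1; critical-path width 0 = NODE O; D4 DISCHARGE NO DATE).  No `def`, no named fact, no `sorry`, standard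
axioms.
HONEST DEPENDENCY: continuum YM on T⁴ ⇐ BetaPertH ∧ nine spine estimates (0/9 proved); BetaPertH ⇐ (D1) ∧ (D4) ∧
CAP+tail; G-an2-4 gates asym, D1 and NE2/3/4.

Sources: [I] = T. Bałaban, *Renormalization group approach to lattice gauge field theories. I*, Commun. Math. Phys.
**109** (1987) 249–301 [Balaban1987RG1], (1.7) p. 261, (1.21) p. 264; [II] = T. Bałaban, *Renormalization group
approach to lattice gauge field theories. II. Cluster expansions*, Commun. Math. Phys. **116** (1988) 1–22
[Balaban1988RG2Cluster], (2.11)–(2.13) p. 14, p. 15; R. Kotecký, D. Preiss, *Cluster expansion for abstract polymer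
models*, Commun. Math. Phys. **103** (1986) 491–498 [KoteckyPreiss1986].
-/

namespace Literature.MathematicalPhysics.QuantumFieldTheory.Balaban1983to89.Beta.RemainderFacFromActivities

open Literature.MathematicalPhysics.QuantumFieldTheory.Balaban1983to89
open Literature.Probability.LatticeModels (truncatedWeight truncatedWeight_image)
open Literature.MathematicalPhysics.QuantumFieldTheory.Balaban1983to89.B13ScaleTransfer (Pt Adj)
open Literature.MathematicalPhysics.QuantumFieldTheory.Balaban1983to89.B13FamilySum (coveringFamilies mem_coveringFamilies)
open Literature.MathematicalPhysics.QuantumFieldTheory.Balaban1983to89.B13Resummation (locE)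
open Literature.MathematicalPhysics.QuantumFieldTheory.Balaban1983to89.TreeLengthTorus (TPt TDom TAdj proj proj_adj)
open Literature.MathematicalPhysics.QuantumFieldTheory.Balaban1983to89.TreeLengthTorusGeometry (TTouch)
open Literature.MathematicalPhysics.QuantumFieldTheory.Balaban1983to89.TreeLengthCubeSystem (Dom IsDom Touch mem_cellsOf)
open Literature.MathematicalPhysics.QuantumFieldTheory.Balaban1983to89.B12Decay510Torus
  (pabs vmaVec vmaVec_injective proj_vmaVec)
open Literature.MathematicalPhysics.QuantumFieldTheory.Balaban1983to89.Beta.RemainderLimitTorus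
  (LDom IsLDom tproj tproj_val InBox Small liftDom liftDom_val liftDom_tproj small_tproj image_vmaVec_tproj
    vmaVec_proj_of_abs_le adj_vmaVec pabs_proj_le)
open Literature.MathematicalPhysics.QuantumFieldTheory.Balaban1983to89.Beta.RemainderStepAdapterHolo (StepObjectD4)
open Filter

variable {d : ℕ}

/-! ## 1. Small torus domains ↔ localization domains inside a window of ℤ^d -/

section Window

variable {N : ℕ} [NeZero N] {R : ℕ}

/-- In the box (2R + 3 ≤ N) the reduction mod N is injective on lattice points. [folklore] -/
private theorem proj_eq_proj_iff (hN : 2 * R + 3 ≤ N) {x y : Pt d} (hx : ∀ i, |x i| ≤ R) (hy : ∀ i, |y i| ≤ R) :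
    proj N x = proj N y ↔ x = y := by
  refine ⟨fun h => ?_, fun h => h ▸ rfl⟩
  rw [← vmaVec_proj_of_abs_le hN hx, ← vmaVec_proj_of_abs_le hN hy, h]

/-- In the box, torus wall adjacency of the reductions IS lattice wall adjacency (`proj_adj` descends, `adj_vmaVec`
lifts). [cite: Balaban1987RG1, §0 p.257] -/
theorem tadj_proj_iff (hN : 2 * R + 3 ≤ N) {x y : Pt d} (hx : ∀ i, |x i| ≤ R) (hy : ∀ i, |y i| ≤ R) :
    TAdj (proj N x) (proj N y) ↔ Adj x y := by
  refine ⟨fun h => ?_, proj_adj⟩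
  have h' := adj_vmaVec hN (pabs_proj_le hN hx) (pabs_proj_le hN hy) h
  rwa [vmaVec_proj_of_abs_le hN hx, vmaVec_proj_of_abs_le hN hy] at h'

/-- The (2.11) incompatibility of the window system, spelled on the cube sets. [cite: Balaban1988RG2Cluster, (2.11) p.14] -/
theorem touch_iff {B : Finset (Pt d)} (W W' : Dom B) :
    Touch B W W' ↔ ∃ x ∈ W.1, ∃ y ∈ W'.1, x = y ∨ Adj x y := by
  constructor
  · rintro ⟨a, ha, b, hb, hab⟩
    refine ⟨a.1, mem_cellsOf.1 ha, b.1, mem_cellsOf.1 hb, ?_⟩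
    rcases hab with hab | hab
    · exact Or.inl (congrArg Subtype.val hab)
    · exact Or.inr hab
  · rintro ⟨x, hx, y, hy, hxy⟩
    refine ⟨⟨x, W.2.1 hx⟩, mem_cellsOf.2 hx, ⟨y, W'.2.1 hy⟩, mem_cellsOf.2 hy, ?_⟩
    rcases hxy with hxy | hxy
    · exact Or.inl (Subtype.ext hxy)
    · exact Or.inr hxy

/-- A localization domain inside the window Y, as a localization domain of ℤ^d, reduced mod N: its cubes are the
reductions of its cubes. [folklore] -/
private theorem tproj_dom_val (Y : LDom d) (W : Dom Y.1) :
    (tproj N (⟨W.1, W.2.2⟩ : LDom d)).1 = W.1.image (proj N) := rfl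

/-- **The reduction mod N carries the window's (2.11) incompatibility to the torus's**, for a window in the box.
[cite: Balaban1988RG2Cluster, (2.11) p.14] -/
theorem ttouch_tproj_iff (hN : 2 * R + 3 ≤ N) {Y : LDom d} (hY : InBox R Y) (W W' : Dom Y.1) :
    TTouch (tproj N (⟨W.1, W.2.2⟩ : LDom d)) (tproj N (⟨W'.1, W'.2.2⟩ : LDom d)) ↔ Touch Y.1 W W' := by
  rw [touch_iff]
  constructor
  · rintro ⟨a, ha, b, hb, hab⟩
    rw [tproj_dom_val, Finset.mem_image] at ha hb
    obtain ⟨x, hx, rfl⟩ := ha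
    obtain ⟨y, hy, rfl⟩ := hb
    refine ⟨x, hx, y, hy, ?_⟩
    rcases hab with hab | hab
    · exact Or.inl ((proj_eq_proj_iff hN (hY x (W.2.1 hx)) (hY y (W'.2.1 hy))).1 hab)
    · exact Or.inr ((tadj_proj_iff hN (hY x (W.2.1 hx)) (hY y (W'.2.1 hy))).1 hab)
  · rintro ⟨x, hx, y, hy, hxy⟩
    refine ⟨proj N x, ?_, proj N y, ?_, ?_⟩
    · rw [tproj_dom_val]; exact Finset.mem_image_of_mem _ hx
    · rw [tproj_dom_val]; exact Finset.mem_image_of_mem _ hy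
    rcases hxy with hxy | hxy
    · exact Or.inl (hxy ▸ rfl)
    · exact Or.inr (proj_adj hxy)

/-- **The reduction mod N is injective on the localization domains inside a window in the box** (the torus larger
than the window carries a faithful copy of it, [I] (1.21): *"T^{(j+1)} ↗ ℤ^d"*). [cite: Balaban1987RG1, §0 p.257, (1.21) p.264] -/
theorem tproj_dom_injective (hN : 2 * R + 3 ≤ N) {Y : LDom d} (hY : InBox R Y) :
    Function.Injective fun W : Dom Y.1 => tproj N (⟨W.1, W.2.2⟩ : LDom d) := by
  intro W W' h
  apply Subtype.ext
  have h1 : W.1.image (proj N) = W'.1.image (proj N) := by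
    rw [← tproj_dom_val Y W, ← tproj_dom_val Y W']
    exact congrArg Subtype.val h
  have hinj : Set.InjOn (proj N) (Y.1 : Set (Pt d)) := fun x hx y hy hxy =>
    (proj_eq_proj_iff hN (hY x hx) (hY y hy)).1 hxy
  exact (Finset.image_eq_image_iff_of_injOn hinj W.2.1 W'.2.1).1 h1

/-- The lift by minimal representatives of a torus localization domain in the box reduces back to it (the
localization domains of [I] §0 on the torus vs on ℤ^d). [cite: Balaban1987RG1, §0 p.257, (1.21) p.264] -/
theorem tproj_liftDom (hN : 2 * R + 3 ≤ N) {X : TDom d N} (hs : Small R X.1) : tproj N (liftDom X) = X := by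
  apply Subtype.ext
  rw [tproj_val, liftDom_val hN hs, Finset.image_image]
  conv_rhs => rw [← Finset.image_id (s := X.1)]
  exact Finset.image_congr fun a _ => proj_vmaVec a

/-- A torus sub-domain of the reduction of a window in the box lifts to a localization domain INSIDE the window
([I] §0 p. 257: localization domains = non-empty face-connected families of cubes). [cite: Balaban1987RG1, §0 p.257, (1.21) p.264] -/
theorem isDom_liftDom (hN : 2 * R + 3 ≤ N) {Y : LDom d} (hY : InBox R Y) {Z : TDom d N}
    (hZ : Z.1 ⊆ (tproj N Y).1) : IsDom Y.1 (liftDom Z).1 := by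
  have hs : Small R Z.1 := fun c hc i => small_tproj hN hY c (hZ hc) i
  refine ⟨?_, (liftDom Z).2.1, (liftDom Z).2.2⟩
  rw [liftDom_val hN hs, ← image_vmaVec_tproj hN hY]
  exact Finset.image_subset_image hZ

end Window

/-! ## 2. (2.13) over the torus EQUALS (2.13) over the window, when the activities are read off the window -/

section OneTorus

variable {N : ℕ} [NeZero N] {R : ℕ}

/-- A relabeling followed by its left inverse on `s` gives `s` back. [folklore] -/
private theorem image_image_eq_self {α β : Type*} [DecidableEq α] [DecidableEq β] (s : Finset α) (f : α → β) (g : β → α)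
    (h : ∀ a ∈ s, g (f a) = a) : (s.image f).image g = s := by
  rw [Finset.image_image]
  conv_rhs => rw [← Finset.image_id (s := s)]
  exact Finset.image_congr fun a ha => h a ha

open Classical in
/-- **𝐄^{(k+1)}(Y mod N) IS THE WINDOW-LOCALIZED FUNCTIONAL OF THE ACTIVITIES.**  Let a window Y of ℤ^d lie in the box of
radius R with 2R + 3 ≤ N, and let the activities of the step object at a configuration φ on the torus sub-domains of
`Y mod N` be read off a window assignment: `H (W mod N) φ = w W` for every localization domain W inside Y.  Then
(2.13) on the torus equals (2.13) on the window: `E (Y mod N) φ = locE (Touch Y) (·) w Y` — the sum over the covering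
families of `Y mod N` of the truncated functionals is the sum over the covering families of Y, by relabeling
invariance of `Φ^T` along the bijection `W ↦ W mod N` of §1 (incompatibility and activities preserved).
[cite: Balaban1988RG2Cluster, (2.13) p.14, (2.11) p.14; Balaban1987RG1, (1.7) p.261; KoteckyPreiss1986, (2)] -/
theorem E_tproj_eq_locE_window (O : StepObjectD4 d N) (hN : 2 * R + 3 ≤ N) (Y : LDom d) (hY : InBox R Y)
    (φ : O.Φ) (w : Dom Y.1 → ℂ) (hloc : ∀ W : Dom Y.1, O.H (tproj N (⟨W.1, W.2.2⟩ : LDom d)) φ = w W) :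
    O.E (tproj N Y) φ = locE (Touch Y.1) (fun W : Dom Y.1 => W.1) w Y.1 := by
  unfold StepObjectD4.E locE
  -- the two relabelings: reduction mod N (window → torus) and lift by minimal representatives (torus → window)
  have hsmall : ∀ {Z : TDom d N}, Z.1 ⊆ (tproj N Y).1 → Small R Z.1 := fun hZ c hc i =>
    small_tproj hN hY c (hZ hc) i
  have hRL : ∀ {Z : TDom d N} (hZ : Z.1 ⊆ (tproj N Y).1),
      tproj N (⟨(liftDom Z).1, (isDom_liftDom hN hY hZ).2⟩ : LDom d) = Z := fun hZ =>
    tproj_liftDom hN (hsmall hZ)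
  have hLR : ∀ W : Dom Y.1, (liftDom (tproj N (⟨W.1, W.2.2⟩ : LDom d))).1 = W.1 := fun W =>
    congrArg Subtype.val (liftDom_tproj hN (Y := (⟨W.1, W.2.2⟩ : LDom d)) fun y hy => hY y (W.2.1 hy))
  symm
  refine Finset.sum_bij'
    (fun C' _ => C'.image fun W : Dom Y.1 => (tproj N (⟨W.1, W.2.2⟩ : LDom d) : (TreeLengthTorus.tsys d N).Dom))
    (fun C _ => C.image fun Z : (TreeLengthTorus.tsys d N).Dom =>
      if h : Z.1 ⊆ (tproj N Y).1 then (⟨(liftDom Z).1, isDom_liftDom hN hY h⟩ : Dom Y.1)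
      else ⟨Y.1, subset_rfl, Y.2⟩)
    ?_ ?_ ?_ ?_ ?_
  · -- the reduced family covers `Y mod N`
    intro C' hC'
    rw [mem_coveringFamilies] at hC' ⊢
    refine ⟨Finset.subset_univ _, ?_⟩
    rw [Finset.image_biUnion, tproj_val]
    conv_rhs => rw [← hC'.2, Finset.biUnion_image]
    exact Finset.biUnion_congr rfl fun W _ => tproj_dom_val Y W
  · -- the lifted family covers `Y`
    intro C hC
    rw [mem_coveringFamilies] at hC ⊢
    have hsub : ∀ Z ∈ C, Z.1 ⊆ (tproj N Y).1 := fun Z hZ =>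
      hC.2 ▸ Finset.subset_biUnion_of_mem (fun Z : (TreeLengthTorus.tsys d N).Dom => Z.1) hZ
    refine ⟨Finset.subset_univ _, ?_⟩
    rw [Finset.image_biUnion]
    apply Finset.Subset.antisymm
    · refine Finset.biUnion_subset.2 fun Z hZ => ?_
      rw [dif_pos (hsub Z hZ)]
      exact (isDom_liftDom hN hY (hsub Z hZ)).1
    · intro y hy
      have hy' : proj N y ∈ C.biUnion fun Z : (TreeLengthTorus.tsys d N).Dom => Z.1 := by
        rw [hC.2, tproj_val]; exact Finset.mem_image_of_mem _ hy
      obtain ⟨Z, hZ, hyZ⟩ := Finset.mem_biUnion.1 hy'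
      refine Finset.mem_biUnion.2 ⟨Z, hZ, ?_⟩
      rw [dif_pos (hsub Z hZ), liftDom_val hN (hsmall (hsub Z hZ))]
      exact Finset.mem_image.2 ⟨proj N y, hyZ, vmaVec_proj_of_abs_le hN (hY y hy)⟩
  · -- lift ∘ reduce = id on families inside Y
    intro C' _
    refine image_image_eq_self C' _ _ fun W _ => ?_
    have hW : (tproj N (⟨W.1, W.2.2⟩ : LDom d)).1 ⊆ (tproj N Y).1 := by
      rw [tproj_dom_val, tproj_val]; exact Finset.image_subset_image W.2.1
    show (if h : _ then _ else _) = W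
    rw [dif_pos hW]
    exact Subtype.ext (hLR W)
  · -- reduce ∘ lift = id on families inside `Y mod N`
    intro C hC
    rw [mem_coveringFamilies] at hC
    have hsub : ∀ Z ∈ C, Z.1 ⊆ (tproj N Y).1 := fun Z hZ =>
      hC.2 ▸ Finset.subset_biUnion_of_mem (fun Z : (TreeLengthTorus.tsys d N).Dom => Z.1) hZ
    refine image_image_eq_self C _ _ fun Z hZ => ?_
    show tproj N _ = Z
    simp only [dif_pos (hsub Z hZ)]
    exact hRL (hsub Z hZ)
  · -- relabeling invariance of Φ^T along W ↦ W mod N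
    intro C' _
    exact (truncatedWeight_image (inc := Touch Y.1) (inc' := TTouch (d := d) (N := N)) (w := w)
      (w' := fun Z : (TreeLengthTorus.tsys d N).Dom => O.H Z φ) (C := C')
      ((tproj_dom_injective hN hY).injOn) (fun a _ b _ => ttouch_tproj_iff hN hY a b)
      (fun a _ => hloc a)).symm

end OneTorus

/-! ## 3. The leaf `hfac` FROM activity-level locality, on any carrier -/

section Eventually

/-- Every window lies in the box of radius `R := max over its cubes and coordinates of |y i|`. [folklore] -/
private theorem inBox_sup (Y : LDom d) :
    InBox (Y.1.sup fun y => Finset.univ.sup fun i => (y i).natAbs) Y := by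
  intro y hy i
  have h1 : (y i).natAbs ≤ Finset.univ.sup (fun i => (y i).natAbs) :=
    Finset.le_sup (f := fun i => (y i).natAbs) (Finset.mem_univ i)
  have h2 : (Finset.univ.sup fun i => (y i).natAbs) ≤ Y.1.sup (fun y => Finset.univ.sup fun i => (y i).natAbs) :=
    Finset.le_sup (f := fun y => Finset.univ.sup fun i => (y i).natAbs) hy
  rw [Int.abs_eq_natAbs]
  exact_mod_cast h1.trans h2

open Classical in
/-- **THE LEAF `hfac` FROM ACTIVITY-LEVEL LOCALITY (any carrier).**  For an exhausting torus sequence `N n → ∞`, thin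
step objects `O n`, a seam `emb n X : Wn n → (O n).Φ`, read-out maps `r n : Wn n → V` and test sets `S n ⊆ Wn n`: IF,
eventually in n, the activity of every torus sub-domain `W mod N n` of `Y mod N n` along the seam is a window
functional of the read-out — `(O n).H (W mod N n) (emb n (Y mod N n) v) = w W (r n v)` for `v ∈ S n` (locality of the
localized activities + their independence of the volume, [II] p. 15 with (2.16) ff.; the HYPOTHESIS `hloc`) — THEN,
eventually in n, `(O n).E (Y mod N n) (emb n (Y mod N n) v) = F Y (r n v)` on `S n` with the window functional
`F Y u := locE (Touch Y) (·) (fun W => w W u) Y` written in the statement: the leaf `hfac` of `PolLeavesTFac190H`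
([I] (1.7) p. 261, (1.21) p. 264), e.g. with `Wn n := TPt d (N n·M) → ℂ`, `r n := restrictCLM (N n·M) (e Y)`,
`S n := ball 0 α₂`. [cite: Balaban1987RG1, (1.7) p.261, (1.21) p.264; Balaban1988RG2Cluster, (2.13) p.14 and p.15] -/
theorem eventually_fac_of_activities (N : ℕ → ℕ) [∀ n, NeZero (N n)] (hNlim : Tendsto N atTop atTop)
    (O : (n : ℕ) → StepObjectD4 d (N n)) {Wn : ℕ → Type*} {V : Type*}
    (emb : (n : ℕ) → TDom d (N n) → Wn n → (O n).Φ) (r : (n : ℕ) → Wn n → V) (S : (n : ℕ) → Set (Wn n))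
    (Y : LDom d) (w : Dom Y.1 → V → ℂ)
    (hloc : ∀ᶠ n in atTop, ∀ W : Dom Y.1, ∀ v ∈ S n,
      (O n).H (tproj (N n) (⟨W.1, W.2.2⟩ : LDom d)) (emb n (tproj (N n) Y) v) = w W (r n v)) :
    ∀ᶠ n in atTop, ∀ v ∈ S n,
      (O n).E (tproj (N n) Y) (emb n (tproj (N n) Y) v) =
        locE (Touch Y.1) (fun W : Dom Y.1 => W.1) (fun W => w W (r n v)) Y.1 := by
  filter_upwards [hloc, hNlim.eventually_ge_atTop
    (2 * (Y.1.sup fun y => Finset.univ.sup fun i => (y i).natAbs) + 3)] with n hn hNn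
  intro v hv
  exact E_tproj_eq_locE_window (O n) hNn Y (inBox_sup Y) _ _ fun W => hn W v hv

end Eventually

end Literature.MathematicalPhysics.QuantumFieldTheory.Balaban1983to89.Beta.RemainderFacFromActivities
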